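import Summits.CriticalPhenomena.PercolationContinuityZ3.Theorems.PercNearOneGluingNoHeavyLowerTailMajorityGluingQCert3SixFive
import Summits.CriticalPhenomena.PercolationContinuityZ3.Theorems.PercNearOneGluingNoHeavyLowerTailMajorityGluingQCert3Slice
import HarnessLib

/-!
# The degree-3 certificate `sixFive3`: slice checks 52, 53 (lane prim-rate, constants-miner 1; generated by census/g34/cert/mk3slices.py)

Support file for the closed crux `NoHeavyLowerTail` (stmt-CriticalPhenomena-4575), majority-gluing line.  `decide +kernel` evaluations of `Cert3.checkSlice` on `QCert.sixFive3`.  No sorries.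
-/

namespace Summit.CriticalPhenomena.PercolationContinuityZ3.Theorems

namespace HubOnly
namespace QCert

set_option maxHeartbeats 0 in
/-- Slice `52` of the degree-3 certificate `sixFive3` passes (contributions with smallest index `52`, sorted and run-scanned in the kernel). -/
theorem sixFive3_slice_52 : sixFive3.checkSlice 52 16 = true := by decide +kernel

set_option maxHeartbeats 0 in
/-- Slice `53` of the degree-3 certificate `sixFive3` passes (contributions with smallest index `53`, sorted and run-scanned in the kernel). -/
theorem sixFive3_slice_53 : sixFive3.checkSlice 53 16 = true := by decide +kernel

end QCert
end HubOnly

end Summit.CriticalPhenomena.PercolationContinuityZ3.Theorems
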